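import Summits.BirchSwinnertonDyer.BirchSwinnertonDyer.Theses.TwistFamilyManinDescent
import Summits.BirchSwinnertonDyer.BirchSwinnertonDyer.Theorems.TeichmullerTwistDescentCellsOfKato
import HarnessLib

/-!
# Route `TwistFamilyManinDescent` — the support item `IrreducibleAdditiveManinUnit` (stmt-BirchSwinnertonDyer-25140)
# closed by name, from modularity and Kato's fact F″ (the Ihara³ binder is IDLE)

HONEST FRAMING. The item is the CONDITIONAL statement
`exists_isNewformOf → F″ → Ihara³ → (∀ W globally minimal, p ≥ 5 additive, E[p] irreducible, D lattice-optimal at any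
level: p ∤ c(D))`. It is proved here by the cell's landed Ihara-free theorem
`TeichmullerTwistDescent.not_dvd_c_of_kato` (seat bsd-line-ttd-p2 g3, p596449: Kato road + the PROVED Chebotarev
transfer witness `AuxPrime.transferWitness` of seat bsd-wall-manin-p1 g7), so only the first two hypotheses are
consumed: the Ihara³ binder (`diamondRibet1997_iharaLemma_sq`) of the item is not needed. The two consumed
hypotheses are cite-only PRINTED facts (BCDT modularity; F″ = Kato 2004 (8.1.3)/Thm 9.7 + Kim–Nakamura §2, XL,
referee-flagged); nothing unconditional about Manin constants is proved here, and BSD is not proved by this.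
-/

-- D-0017: single-problem summit, so `Summit.BirchSwinnertonDyer.BirchSwinnertonDyer.…` repeats a namespace BY DESIGN.
set_option linter.dupNamespace false

namespace Summit.BirchSwinnertonDyer.BirchSwinnertonDyer.Theorems.TwistFamilyManinDescent

open Summit.BirchSwinnertonDyer.BirchSwinnertonDyer.Theses.TwistFamilyManinDescent

/-- **Item stmt-BirchSwinnertonDyer-25140 by name.** `IrreducibleAdditiveManinUnit`: granted modularity
(`exists_isNewformOf`) and Kato–Néron integrality F″, for every globally minimal `W/ℚ`, every prime `p ≥ 5` of
additive reduction with `E[p]` irreducible and every lattice-optimal parametrisation datum `D` at any level,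
`p ∤ c(D)` — `TeichmullerTwistDescent.not_dvd_c_of_kato`; the item's third hypothesis (Ihara³) is idle.
[cite: Kato2004Asterisque, (8.1.3) (p. 180), Thm. 9.7 (p. 189)] [cite: KostersPannekoek2017, Thm. 1 and Cor. 2]
[cite: BCDTJAMS2001, Thm. A] -/
theorem irreducibleAdditiveManinUnit_proof : IrreducibleAdditiveManinUnit := by
  unfold IrreducibleAdditiveManinUnit
  intro hnf hK _hI W _ _ p _ N _ D hp5 hadd hirr hlat
  exact TeichmullerTwistDescent.not_dvd_c_of_kato hnf hK W p D hp5 hadd hirr hlat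

end Summit.BirchSwinnertonDyer.BirchSwinnertonDyer.Theorems.TwistFamilyManinDescent
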